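import Literature.MathematicalPhysics.QuantumLattice.InfVolFermionStateSpinFlip
import Literature.MathematicalPhysics.QuantumLattice.HubbardEnergyDensityVariationalPrinciple
import Literature.MathematicalPhysics.QuantumLattice.HubbardChainTorusLimitState
import HarnessLib

/-!
# Spin-symmetric minimisers of the Hubbard variational principle

Topic `MathematicalPhysics/QuantumLattice`. Averaging an infinite-volume state with its spin-flipped
state (`InfVolFermionStateSpinFlip.lean`), `ω̄ = ½ ω + ½ (ω ∘ Γ_swap)` (`InfVolFermionState.spinSym`),
preserves translation invariance, evenness, the particle density and the Hubbard energy density (the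
Hubbard interaction is symmetric between the spins, Lieb 1989) and makes the spin densities equal:
`ω̄(n_{0↑}) = ω̄(n_{0↓}) = ρ/2` (`spinFlip_spinSym`, `spinSym_expect_nAt`; a spin-flip invariant state has equal spin
densities, `expect_nAt_eq_of_spinFlip_eq`). Consequently the translation-invariant minimisers of
Ruelle's ground-state energy density may be taken SPIN SYMMETRIC:

* `le_energyDensity2D_of_forall_spinFlip_eq` / `…_of_forall_spinSymmetric` (`d = 2`, `U ≥ 0`,
  `0 ≤ n < 2`): a real number that bounds from below the Hubbard energy density of every
  translation-invariant, even, spin-flip invariant state of density `n` (resp. with spin densities `n/2`)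
  bounds `energyDensity2D t U n`;
* `le_hubbardChainEnergyDensityAt_of_forall_spinFlip_eq` / `…_of_forall_spinSymmetric` (`d = 1`,
  filling `p/q`): the same for `hubbardChainEnergyDensityAt t U p q`.

This is the state class on which bootstrap rows issued WITH the spin-flip symmetry (`spin flip ∈ G`
of the relaxation) or with the constant matrix `C(ρ/2)` of the Pauli–Markov matrix cuts are valid
by name, without a torus pull-back. Everything is PROVED; the only definition is `spinSym ω` (with body).

## References
* E. H. Lieb, *Two theorems on the Hubbard model*, Phys. Rev. Lett. 62 (1989) 1201, proof of Thm. 1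
  (spin-exchange symmetry of the Hubbard Hamiltonian). [cite: LiebPRL1989, proof of Theorem 1]
* O. Bratteli, A. Kishimoto, D. W. Robinson, Commun. Math. Phys. 64 (1978) 41–48, §3 Thm. 2 (the
  translation-invariant minimisers of the mean energy form a face; averaging over a symmetry of the
  interaction stays in it). [cite: BratteliKishimotoRobinson1978, §3]
* D. Ruelle, *Statistical Mechanics: Rigorous Results* (Benjamin 1969), §3.4. [cite: Ruelle1969, §3.4]
-/

noncomputable section

namespace Literature.MathematicalPhysics.QuantumLattice

open Matrix Finset HubbardWave0 _root_.Filter Literature.Probability.LatticeModels ThermodynamicLimit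
open scoped _root_.Topology ComplexOrder

namespace InfVolFermionState

variable {d : ℕ} (ω : InfVolFermionState d)

/-- **The spin-symmetrised state** `ω̄ = ½ ω + ½ (ω ∘ Γ_swap)`. [cite: BratteliKishimotoRobinson1978, §3] -/
def spinSym (ω : InfVolFermionState d) : InfVolFermionState d :=
  mix (1 / 2) (by norm_num) (by norm_num) ω ω.spinFlip

/-- The local expectations of `ω̄`. [cite: BratteliKishimotoRobinson1978, §3] -/
theorem spinSym_expect (Λ : Finset (Site d)) (A : FermionOp Λ) :
    ω.spinSym.expect Λ A = (1 / 2 : ℂ) * ω.expect Λ A +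
      (1 / 2 : ℂ) * ω.expect Λ (relabel (Orb.spinSwap : Orb (PolySite Λ) ≃ Orb (PolySite Λ)) A) := by
  rw [spinSym, mix_expect, spinFlip_expect]
  push_cast
  norm_num

/-- `ω̄` is translation invariant if `ω` is. [cite: BratteliKishimotoRobinson1978, §3] -/
theorem IsTranslationInvariant.spinSym {ω : InfVolFermionState d} (hω : ω.IsTranslationInvariant) :
    ω.spinSym.IsTranslationInvariant :=
  hω.mix hω.spinFlip _ _ _

/-- `ω̄` is even if `ω` is. [cite: ArakiMoriya2003, §4.1 Def. 4.5] -/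
theorem IsEven.spinSym {ω : InfVolFermionState d} (hω : ω.IsEven) : ω.spinSym.IsEven :=
  hω.mix hω.spinFlip _ _ _

/-- `ω̄` has the particle density of `ω`. [cite: ArakiMoriya2003, §4.1] -/
theorem densityAt_spinSym (x : Site d) : ω.spinSym.densityAt x = ω.densityAt x := by
  have h := ω.densityAt_spinFlip x
  rw [densityAt] at h ⊢
  rw [densityAt, spinSym, mix_expect, Complex.add_re, Complex.re_ofReal_mul, Complex.re_ofReal_mul, h,
    densityAt]
  ring

/-- `ρ_{ω̄} = ρ_ω`. [cite: ArakiMoriya2003, §4.1] -/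
theorem density_spinSym : ω.spinSym.density = ω.density :=
  ω.densityAt_spinSym 0

/-- `ω̄` has the Hubbard energy density of `ω`. [cite: LiebPRL1989, proof of Theorem 1] -/
theorem hubbardEnergyDensity_spinSym (t U : ℝ) :
    ω.spinSym.hubbardEnergyDensity t U = ω.hubbardEnergyDensity t U := by
  have h := ω.hubbardEnergyDensity_spinFlip t U
  unfold InfVolFermionState.hubbardEnergyDensity at h ⊢
  rw [spinSym, meanEnergy_mix, h]
  ring

/-- The one-site density observable has real expectation `ρ_ω(x)`. [cite: ArakiMoriya2003, §4.1] -/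
theorem expect_nAt_add_nAt (x : Site d) :
    ω.expect {x} (nAt x (Finset.mem_singleton_self x) 0 + nAt x (Finset.mem_singleton_self x) 1) =
      ((ω.densityAt x : ℝ) : ℂ) := by
  have him : (ω.expect {x} (nAt x (Finset.mem_singleton_self x) 0 + nAt x (Finset.mem_singleton_self x) 1)).im = 0 := by
    refine ω.expect_im_eq_zero_of_isHermitian ?_
    rw [nAt, nAt, ← numberAt_orb, ← numberAt_orb]
    exact (numberAt_isHermitian _).add (numberAt_isHermitian _)
  exact Complex.ext (by rw [densityAt, Complex.ofReal_re]) (by rw [him, Complex.ofReal_im])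

/-- `n_{xσ} + n_{xσ̄} = n_{x↑} + n_{x↓}`. [cite: LiebPRL1989, eq. (2)] -/
theorem nAt_add_nAt_swap {Λ : Finset (Site d)} (x : Site d) (hx : x ∈ Λ) (σ : Fin 2) :
    nAt x hx σ + nAt x hx (Equiv.swap (0 : Fin 2) 1 σ) = nAt x hx 0 + nAt x hx 1 := by
  fin_cases σ
  · simp
  · simp [add_comm]

/-- **`ω̄` is spin-flip invariant**: `ω̄ ∘ Γ_swap = ω̄`. [cite: BratteliKishimotoRobinson1978, §3] -/
theorem spinFlip_spinSym : ω.spinSym.spinFlip = ω.spinSym := by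
  refine InfVolFermionState.ext fun Λ => LinearMap.ext fun A => ?_
  rw [spinFlip_expect, spinSym_expect, spinSym_expect, relabel_spinSwap_relabel_spinSwap, add_comm]

/-- **A spin-flip invariant state has equal spin densities**: `ω(n_{xσ}) = ρ_ω(x)/2`. [cite: ArakiMoriya2003, §4.1] -/
theorem expect_nAt_eq_of_spinFlip_eq {ω : InfVolFermionState d} (h : ω.spinFlip = ω) (x : Site d) (σ : Fin 2) :
    ω.expect {x} (nAt x (Finset.mem_singleton_self x) σ) = (((ω.densityAt x / 2 : ℝ)) : ℂ) := by
  have h1 : ω.expect {x} (nAt x (Finset.mem_singleton_self x) σ) =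
      ω.expect {x} (nAt x (Finset.mem_singleton_self x) (Equiv.swap (0 : Fin 2) 1 σ)) := by
    conv_lhs => rw [← h]
    rw [spinFlip_expect_nAt]
  have hsum : ω.expect {x} (nAt x (Finset.mem_singleton_self x) σ) +
      ω.expect {x} (nAt x (Finset.mem_singleton_self x) (Equiv.swap (0 : Fin 2) 1 σ)) = ((ω.densityAt x : ℝ) : ℂ) := by
    rw [← map_add, nAt_add_nAt_swap, expect_nAt_add_nAt]
  push_cast
  linear_combination (hsum + h1) / 2

/-- **`ω̄` is spin symmetric**: `ω̄(n_{xσ}) = ρ_ω(x)/2` for both spins. [cite: ArakiMoriya2003, §4.1] -/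
theorem spinSym_expect_nAt (x : Site d) (σ : Fin 2) :
    ω.spinSym.expect {x} (nAt x (Finset.mem_singleton_self x) σ) = (((ω.densityAt x / 2 : ℝ)) : ℂ) := by
  rw [expect_nAt_eq_of_spinFlip_eq ω.spinFlip_spinSym, densityAt_spinSym]

end InfVolFermionState

/-! ### The variational class may be taken spin symmetric -/

section Variational

variable (t : ℝ)

/-- **Transport of lower bounds valid for spin-flip invariant translation-invariant states (`d = 2`).**
If `E` bounds from below the Hubbard energy density of every translation-invariant, even, SPIN-FLIP
INVARIANT (`ω ∘ Γ_swap = ω`) state on `ℤ²` of density `n`, then `E ≤ energyDensity2D t U n` (`U ≥ 0`,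
`0 ≤ n < 2`): symmetrise the minimiser of the variational principle. [cite: BratteliKishimotoRobinson1978, §3] -/
theorem le_energyDensity2D_of_forall_spinFlip_eq {U : ℝ} (hU : 0 ≤ U) {n : ℝ} (hn0 : 0 ≤ n) (hn2 : n < 2)
    {E : ℝ}
    (hE : ∀ ω : InfVolFermionState 2, ω.IsTranslationInvariant → ω.IsEven → ω.density = n →
      ω.spinFlip = ω → E ≤ ω.hubbardEnergyDensity t U) :
    E ≤ energyDensity2D t U n := by
  obtain ⟨ω, hti, hev, hdens, he⟩ :=
    InfVolFermionState.exists_isTranslationInvariant_hubbardEnergyDensity_eq t hU hn0 hn2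
  rw [← he, ← ω.hubbardEnergyDensity_spinSym t U]
  exact hE ω.spinSym hti.spinSym hev.spinSym (by rw [ω.density_spinSym, hdens]) ω.spinFlip_spinSym

/-- The same with the spin densities `ω(n_{0↑}) = ω(n_{0↓}) = n/2` as the hypothesis (the form used by
rows whose constant involves the spin density, e.g. the Pauli–Markov matrix cuts with `C(n/2)`).
[cite: BratteliKishimotoRobinson1978, §3] -/
theorem le_energyDensity2D_of_forall_spinSymmetric {U : ℝ} (hU : 0 ≤ U) {n : ℝ} (hn0 : 0 ≤ n) (hn2 : n < 2)
    {E : ℝ}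
    (hE : ∀ ω : InfVolFermionState 2, ω.IsTranslationInvariant → ω.IsEven → ω.density = n →
      (∀ σ : Fin 2, ω.expect {0} (nAt 0 (Finset.mem_singleton_self 0) σ) = (((n / 2 : ℝ)) : ℂ)) →
      E ≤ ω.hubbardEnergyDensity t U) :
    E ≤ energyDensity2D t U n := by
  refine le_energyDensity2D_of_forall_spinFlip_eq t hU hn0 hn2 fun ω hti hev hdens hflip => ?_
  refine hE ω hti hev hdens fun σ => ?_
  rw [InfVolFermionState.expect_nAt_eq_of_spinFlip_eq hflip, ← InfVolFermionState.density, hdens]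

/-- **Transport of lower bounds valid for spin-flip invariant translation-invariant states (`d = 1`,
filling `p/q`).** [cite: BratteliKishimotoRobinson1978, §3] -/
theorem le_hubbardChainEnergyDensityAt_of_forall_spinFlip_eq {U : ℝ} (hU : 0 ≤ U) {p q : ℕ} (hq : 1 ≤ q)
    (hp : p ≤ 2 * q) {E : ℝ}
    (hE : ∀ ω : InfVolFermionState 1, ω.IsTranslationInvariant → ω.IsEven → ω.density = (p : ℝ) / q →
      ω.spinFlip = ω → E ≤ ω.hubbardEnergyDensity t U) :
    E ≤ hubbardChainEnergyDensityAt t U p q := by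
  obtain ⟨ω, hti, hev, hdens, he⟩ := exists_isTranslationInvariant_hubbardEnergyDensity_eq_chainAt t hU hq hp
  rw [← he, ← ω.hubbardEnergyDensity_spinSym t U]
  exact hE ω.spinSym hti.spinSym hev.spinSym (by rw [ω.density_spinSym, hdens]) ω.spinFlip_spinSym

/-- The `d = 1` transport with the spin densities `p/(2q)` as the hypothesis. [cite: BratteliKishimotoRobinson1978, §3] -/
theorem le_hubbardChainEnergyDensityAt_of_forall_spinSymmetric {U : ℝ} (hU : 0 ≤ U) {p q : ℕ} (hq : 1 ≤ q)
    (hp : p ≤ 2 * q) {E : ℝ}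
    (hE : ∀ ω : InfVolFermionState 1, ω.IsTranslationInvariant → ω.IsEven → ω.density = (p : ℝ) / q →
      (∀ σ : Fin 2, ω.expect {0} (nAt 0 (Finset.mem_singleton_self 0) σ) = ((((p : ℝ) / q / 2 : ℝ)) : ℂ)) →
      E ≤ ω.hubbardEnergyDensity t U) :
    E ≤ hubbardChainEnergyDensityAt t U p q := by
  refine le_hubbardChainEnergyDensityAt_of_forall_spinFlip_eq t hU hq hp fun ω hti hev hdens hflip => ?_
  refine hE ω hti hev hdens fun σ => ?_
  rw [InfVolFermionState.expect_nAt_eq_of_spinFlip_eq hflip, ← InfVolFermionState.density, hdens]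

end Variational

end Literature.MathematicalPhysics.QuantumLattice

end
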